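import Summits.BirchSwinnertonDyer.Rank1Residual.O5.O5Targets
import Summits.BirchSwinnertonDyer.Rank1Residual.Supersingular.MazurTateParity
import HarnessLib

/-!
# O5 at `p = 3`: the LAYER LAWS of the Mazur–Tate elements `θ_n(W)` — structural divisibility (T1),
# the BSD-implied PARITY law (T5), the FORCED-Ш law over `ℚ(ζ₉)⁺` (T6), the layer-one λ-law (T7)
# (cell `b2b-bsdres`, lane CLASS-CLOSURE, team o5, planner o5-r1 GEN 2 — E1 statement discovery;
#  content = o5-r1, placement + dedup = class typer) — TYPED, EVIDENCE-LABELLED, NOTHING ASSERTED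

HONEST FRAMING (cell `b2b-bsdres`, verbatim in every file): the goal of the cell is to DELETE the
COMBINATION-SHAPED residual classes of the Birch–Swinnerton-Dyer formula for ALL analytic-rank `≤ 1`
elliptic curves over `ℚ` — "full BSD formula for every rank `≤ 1` curve in class `C`" assembled
STRICTLY from published theorems — so that the rank-`≤ 1` remainder becomes exactly the
CONSTRUCTION-SHAPED classes, which are TYPED (missing-input `Prop`s), NOT attempted. This is not
"finishing BSD". Lane CLASS-CLOSURE: census output is EVIDENCE / conjecture items with held-out
validation, never a Literature fact; no main conjecture inside any certificate; nothing is booked.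

## What is typed here (all over the tree's `mazurTateElement f 3 n ∈ ℚ[X]`, Pollack 2003 Def. 6.15,
## and the cell's `μ`/`λ` of `X1/MuLambdaAlgebra.lean`; class predicates of `Additive/PotSupersingularClasses.lean`)

Setting: `W/ℚ` in class O5 at `p = 3` (`ClassO5 W 3`: additive, tame, potentially supersingular;
O5a = `SubGss` (`e = 2`, Kodaira `I₀*`, `v₃(Δ) = 6`), O5b = `SubTprime` (`e = 4`, Kodaira III
(`v₃(Δ) = 3`) / III* (`v₃(Δ) = 9`)); `a₃(W) = 0`; `k_n` = the `n`-th layer of the cyclotomic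
`ℤ₃`-extension (`k₁ = ℚ(ζ₉)⁺`); `θ_n = θ_n(f_W)` the Mazur–Tate element at level `3^{n+1}`
(even branch; PARI/`msfromell` normalisation `x⁺({0,∞}) = −L(W,1)/Ω_W` checked on every rank-0 row).

* **T1 (`OmegaDvdMazurTateThree`, THEOREM-CANDIDATE, not a conjecture — and a KERNEL THEOREM since 2026-08-21:
  `O5.omegaDvdMazurTateThree_holds`, x11b3-p1 GEN 11 p305243, see the docstring)**: `ω_{n−1} ∣ θ_n` in `ℚ[X]`
  for every `n ≥ 1` — because `T₃ = U₃` at level `9M` and `a₃(W) = 0`, the norm-compatible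
  projection of `θ_n` to layer `n − 1` is `a₃ θ_{n−1} = 0`.  Write `θ_n = ω_{n−1} · u_n`,
  `deg u_n < 2·3^{n−1}`; then `λ(θ_n) = 3^{n−1} + λ(u_n)`, `μ(θ_n) = μ(u_n)`, and (Weierstrass
  preparation, `deg u_n < e(ℚ₃(ζ_{3^n})/ℚ₃)`) `Σ_{κ primitive of level n} ord₃ u_n(ζ_κ − 1) =
  2·3^{n−1} μ(u_n) + λ(u_n)` EXACTLY.  EVIDENCE: exact rational arithmetic, kit `j121751`,
  `j121825`, `j122348` (every curve, every layer `n ≤ 5/6`, both branches: quotient remainder `0`).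
* **T5 (`LayerParityLawThree`, CONJECTURE, BSD-IMPLIED)**: for every `n ≥ 1` with `θ_n(W) ≠ 0`,
  `λ(θ_n(W)) ≡ r_an(W) (mod 2)` on O5b and `λ(θ_n(W)) ≡ r_an(W) + 1 (mod 2)` on O5a.
  DERIVATION (o5-r1 gen 2, `HOME/b2b-bsdres-o5-r1/gen2/LAYER-LAWS.md` §2): BSD over `k_{n−1}` and
  `k_n` + Cassels–Tate (`#Ш(W/k_m)[3^∞]` a square) + the exact period bookkeeping
  `ord₃(Ω_{W/k_{m+1}}/Ω_{W/k_m}^{3}) = f_m(W) := ⌊3^{m+1}v₃(Δ_W)/12⌋ − ⌊3^m v₃(Δ_W)/12⌋`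
  (Lei–Pollack–Pratap arXiv:2412.16629 eq. (perratio) p.13, with the FLOORS their Thm 4.7 omits; `f_m` is
  EVEN on O5b and ODD (`= 3^m`) on O5a), Tamagawa changes `2·3^m·Σ ord₃ c_ℓ` and torsion changes
  being EVEN, give `e_{m+1} − e_m ≡ 1 + λ(u_{m+1}) − f_m − r_an (mod 2)`.  It is `μ`-FREE and
  Tamagawa-free, and it is NOT a consequence of the functional equation of `θ_n`
  (`Supersingular/MazurTateFunctionalEquation.lean` needs `p ∤ N`: at an additive `p` the Fricke
  involution does not preserve the `p`-power cusps) — on O5a the parity is OPPOSITE to the good-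
  reduction law `(−1)^{λ(θ_n)} = w(W)` of `MazurTateParity.lean`.  EVIDENCE: kit `j121751/j121825`
  (7650d1 r0 O5b: λ(θ_n) = 2,4,12,34,102; 19530c1 r0 O5b: 2,4,10,28,82; 2205l1 r0 O5a: 1,7,17,49,143;
  585b1 r0 X3-O5b: 2,8,26,80,242) and the pilot `j122348` (per-curve table in LAYER-LAWS.md §4);
  census instrument C-A1′ (two numerical periods `{1/9→4/9}`, `{1/9→7/9}` per curve) tests layer 1
  on all `46 067` O5 rows.
* **T6 (`ForcedShaNineThree`, CONJECTURE, BSD-IMPLIED)**: every O5b curve of Kodaira type III at `3`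
  with `r_an = 0` and `W(ℚ(ζ₉)⁺)[3] = 0` has `9 ∣ #Ш(W/ℚ(ζ₉)⁺)` — precisely
  `ord₃ #Ш(W/ℚ(ζ₉)⁺) = ord₃ #Ш(W/ℚ) + 2 + 2μ(u₁(W))` when no `ℓ ≡ ±1 (mod 9)` has `3 ∣ c_ℓ(W)`
  (layer-one case of the bookkeeping: `f₀(III) = 0` gives no period compensation for the forced
  divisibility T1).  EVIDENCE (independent code path — PARI `ellbsd`/`lfun` over the cubic field, no
  modular symbols): kit `j122314`, all 8 type-III rank-0 rows `N < 8000` of the pilot have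
  `ord₃ Ш_an(W/ℚ(ζ₉)⁺) = 2` (3150f1: 9, 3168e1: 9, 3528c1: 144, 4446k1: 225, 6030a1: 225,
  6498o1: 36, 7650d1: 576, 2205d1 (r1): 9), while type III* rank-0 rows give `ord₃ ∈ {0, 2}`
  (1638a1: 4, 2682b1: 1, 3150c1: 1, 2790e1: 64, 2520k1: 49; 2340a1: 9, 2070b1: 9 ⇒ `μ(u₁) = 1`
  predicted there) — LAYER-LAWS.md §3.  Falsifier: a 3-descent over `ℚ(ζ₉)⁺` (engine ask E-O5-3).
* **T7 (`LayerOneLambdaLawThree`, CONJECTURE = T1 + T5 at `n = 1`)**: `λ(θ₁(W)) ∈ {1, 2}` and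
  `λ(θ₁(W)) = 2 ↔ (W ∈ O5b ↔ r_an(W) even)`.

PLACEMENT (cc-typer-5 gen 2, ask A-O5-7): planner o5-r1 GEN 2's `HOME/b2b-bsdres-o5-r1/gen2/O5LayerLaws.lean`
(sha16 `14afb8b2dc56a81f`) placed by the class typer; declarations VERBATIM, the proof of
`layerParity_one_of_layerOneLambdaLaw` repaired (parity bookkeeping via `Nat.even_add`); the cite key /
attribution of arXiv:2412.16629 corrected to Lei–Pollack–Pratap (`LeiPollackPratap2024`; the planner's
'Lei–Palvannan' was a misattribution); a redundant `Fact (Nat.Prime 3)` instance dropped (Mathlib's is used); report of record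
`HOME/b2b-bsdres-o5-r1/gen2/LAYER-LAWS.md` (sha16 `e3f3f36570abf8b5`). VALIDATION STATUS at placement:
T1 exact on every pilot (curve, layer ≤ 6, branch) (kit j121751 / j121825 / j122348 / j122713); T5/T7
pilot-verified (same jobs) and BSD-DERIVED (LAYER-LAWS.md §2); T6 checked by an INDEPENDENT code path
(PARI nf-BSD over `ℚ(ζ₉)⁺`, kit j122314, 8/8 type-III rows); the all-rows HELD-OUT instrument C-A1′
(layer 1 on all 46 067 O5 rows) is NOT yet run — these are EVIDENCE-labelled conjecture items, never
Literature facts; a census report sha for C-A1′ is to be appended here when it exists.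

References: [MazurTate1987] B. Mazur, J. Tate, Duke Math. J. 54 (1987) 711–750 (modular elements,
"refined BSD"); [Pollack2003] Duke Math. J. 118, Def. 6.15; [LeiPollackPratap2024] A. Lei, R. Pollack, N. Pratap,
arXiv:2412.16629, Thm 4.3/4.5/4.7, §4.3, Conj. 4.11 [corpus: paper-arxiv-2412.16629 p0009–p0016];
[Kato2004] Astérisque 295 Thm 12.5 / Conj 12.10; [DelbourgoCompositio1998] p. 152.  Cell files:
`HOME/cells/o5o6/TARGETS.md` §O5 (o5-r1 GEN 2 block), `HOME/b2b-bsdres-o5-r1/gen2/LAYER-LAWS.md`,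
drivers `HOME/b2b-bsdres-o5-r1/census/mt3_*` (cypari2 `msfromell` driver; client seat, R-291(d)).
-/

set_option autoImplicit false

noncomputable section

open scoped Classical MatrixGroups ModularForm NumberField

open CongruenceSubgroup Polynomial WeierstrassCurve NumberField Literature.NumberTheory.EllipticCurves
  Literature.NumberTheory.EllipticCurves.ModularForms
  Summit.BirchSwinnertonDyer.Rank1Residual.Additive
  Summit.BirchSwinnertonDyer.Rank1Residual.X1.MuLambda

namespace Summit.BirchSwinnertonDyer.Rank1Residual.O5

/-! ## §0 Bookkeeping vocabulary -/

/-- The **period-fudge increment** `f_m(v) = ⌊3^{m+1} v/12⌋ − ⌊3^m v/12⌋` of the step `k_m → k_{m+1}`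
for a curve with `v = v₃(Δ_min)` and tame potentially good reduction at `3`
(`ord₃(Ω_{W/k_{m+1}} / Ω_{W/k_m}^3)`; Lei–Pollack–Pratap arXiv:2412.16629 eq. (perratio), floors restored).
O5b-III (`v = 3`): `0, 2, 4, 14, 40, …`; O5b-III* (`v = 9`): `2, 4, 14, 40, 122, …`; O5a (`v = 6`):
`3^m`. [cite: LeiPollackPratap2024, §4.2 eq. (perratio)] -/
def periodFudgeIncr (v m : ℕ) : ℕ := 3 ^ (m + 1) * v / 12 - 3 ^ m * v / 12

/-- `Θ ∈ Λ = ℤ₃⟦T⟧` is an **integral lift of `3^k · θ_n(f)`**: `ι Θ = 3^k θ_n` in `ℚ₃⟦T⟧` (the scaling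
`3^k` lets non-integral rows — `μ(θ_n) < 0`, reducible `W[3]` — be covered; `λ` is scale-invariant).
[cite: Pollack2003, Def. 6.15] -/
def IsScaledMazurTateLift {N : ℕ} (f : CuspForm (Gamma0 N) 2) (n k : ℕ) (Θ : IwasawaAlgebra 3) : Prop :=
  haveI : Fact (Nat.Prime 3) := ⟨Nat.prime_three⟩
  iwasawaToPowerSeries 3 Θ =
    PowerSeries.C ((3 : ℚ_[3]) ^ k) * ((mazurTateElement f 3 n).map (algebraMap ℚ ℚ_[3]) : PowerSeries ℚ_[3])


/-! ## §1 T1 — the structural divisibility `ω_{n−1} ∣ θ_n` (theorem-candidate) -/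

/-- **T1 (THEOREM-CANDIDATE; `U₃`-vanishing): `ω_{n−1} ∣ θ_n(f_W)` in `ℚ[X]` for `n ≥ 1` on class O5
at `3`.**  Reason: `9 ∣ N_W`, so `T₃ = U₃` on `S₂(Γ₀(N_W))` and `a₃(W) = 0`; the sum of
`[b/3^{n+1}]⁺` over the three lifts `b` of `a mod 3^n` is `a₃ [a/3^n]⁺ = 0`, i.e. the image of `θ_n` in
`ℚ[Γ_{n−1}]` vanishes, i.e. `ω_{n−1} = (1+T)^{3^{n−1}} − 1` divides the degree-`< 3^n` representative.
Consequences used below: `θ_n = ω_{n−1} u_n`, `λ(θ_n) = 3^{n−1} + λ(u_n)`, `μ(θ_n) = μ(u_n)`.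
EVIDENCE: exact on every (curve, layer, branch) of kit j121751 / j121825 / j122348 (remainder `0`).
Typed as a target `Prop` for a prover (Hecke action on `ratPlusSymbol` at a prime dividing the
level); nothing asserted. **PROVED 2026-08-21 (cc-typer-5 GEN 10 restamp): `O5.omegaDvdMazurTateThree_holds :
OmegaDvdMazurTateThree`** (cross-cell pool hand x11b3-p1 GEN 11, `Additive/OmegaDvdMazurTateAddvHolds.lean` p305243)
— the O5 instance of `Additive.omegaDvdMazurTateOfAddv_holds` (EVERY additive prime: `a_p = 0` kills the fibre sums
of the plus symbol, `sum_ratPlusSymbol_add_div_eq_zero_of_addv`, whence `ω_{n−1} ∣ θ_n` by the tree's three-term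
computation at one level, `cyclotomicOmega_dvd_mazurTateElement_succ_of_sum_ratPlusSymbol_eq_zero`); statement
byte-identical; the kit remainders stay EVIDENCE; nothing booked; no mark. [cite: MazurTate1987, §1] -/
def OmegaDvdMazurTateThree : Prop :=
  ∀ (W : WeierstrassCurve ℚ) [W.IsElliptic] [W.IsGloballyMinimal] [NeZero (W.conductorNorm ℤ)]
    (f : CuspForm (Gamma0 (W.conductorNorm ℤ)) 2), IsNewformOf W f → ClassO5 W 3 →
    ∀ n : ℕ, 1 ≤ n → (cyclotomicOmega 3 (n - 1)).map (Int.castRingHom ℚ) ∣ mazurTateElement f 3 n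

/-! ## §2 T5 — the layer PARITY law (BSD-implied conjecture; μ- and Tamagawa-free) -/

/-- **T5 LAYER PARITY LAW at an additive potentially supersingular `3` (CONJECTURE; EVIDENCE-labelled;
implied by BSD over the layers `k_{n−1}, k_n` + Cassels–Tate + the period bookkeeping `f_m`).**
For `W` in class O5 at `3`, every `n ≥ 1` and every integral lift `Θ` of a scaled `θ_n(f_W) ≠ 0`:
`λ(Θ) ≡ r_an(W) (mod 2)` if `W ∈ O5b` (`SubTprime W 3`, `e = 4`), and `λ(Θ) ≡ r_an(W) + 1 (mod 2)` if
`W ∈ O5a` (`SubGss W 3`, `e = 2`) — stated as one `iff`.  NOT the good-reduction functional-equation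
parity (`MazurTateParity.even_lam_mazurTate_iff_even_analyticRank` needs `p ∤ N` and `μ = 0`); on O5a
the sign is opposite.  EVIDENCE: kit j121751, j121825, j122348 (LAYER-LAWS.md §4 table); falsifier:
one O5 row, one layer with the wrong parity (census instrument C-A1′ at layer 1 on all 46 067 rows).
[cite: LeiPollackPratap2024, Thm 4.7 and eq. (pbsd)] -/
@[conjecture] def LayerParityLawThree : Prop :=
  ∀ (W : WeierstrassCurve ℚ) [W.IsElliptic] [W.IsGloballyMinimal] [NeZero (W.conductorNorm ℤ)]
    (f : CuspForm (Gamma0 (W.conductorNorm ℤ)) 2) (n k : ℕ) (Θ : IwasawaAlgebra 3),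
    IsNewformOf W f → ClassO5 W 3 → 1 ≤ n → IsScaledMazurTateLift f n k Θ → Θ ≠ 0 →
    (Even (lam Θ + W.analyticRank) ↔ SubTprime W 3)

/-! ## §3 T6 — the FORCED-Ш law over `k₁ = ℚ(ζ₉)⁺` for Kodaira type III (BSD-implied conjecture) -/

/-- The first layer `k₁ = ℚ(ζ₉)⁺` of the cyclotomic `ℤ₃`-extension of `ℚ` (the cubic field
`x³ − 3x + 1`, discriminant `81`), as the maximal real subfield of `ℚ(ζ₉)`. [folklore] -/
abbrev KOne : Type := maximalRealSubfield (CyclotomicField 9 ℚ)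

/-- **T6 FORCED-Ш LAW (CONJECTURE; EVIDENCE-labelled; implied by BSD(W/ℚ) ∧ BSD(W/ℚ(ζ₉)⁺)).**
Every `W/ℚ` in O5b with Kodaira type III at `3` (`v₃(Δ_min) = 3`), analytic rank `0` and no
`3`-torsion over `ℚ(ζ₉)⁺` has `9 ∣ #Ш(W/ℚ(ζ₉)⁺)` (with `#Ш := Nat.card`, junk `0` — hence the
divisibility trivially — if `Ш` is infinite).  Mechanism: T1 forces `ord₃(τ(κ̄)L(W,κ,1)/Ω_W) ≥ 1` for
the two cubic characters `κ` of conductor `9`; for type III the period of `W` over `k₁` is `Ω_W^3`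
on the nose (`f₀ = 0`; for III* it is `9 Ω_W^3`, which absorbs the divisibility), and `√d_{k₁} = 9`.
EVIDENCE: kit j122314 (PARI nf-BSD, independent of modular symbols): `ord₃ Ш_an(W/ℚ(ζ₉)⁺) = 2` on all
8 type-III rank-0 pilot rows with `N < 8000`; `∈ {0,2}` on the 7 type-III* rows.  Falsifier: a full
`3`-descent over the cubic field on any listed curve (engine ask), or a type-III rank-0 O5b row with
`ord₃ Ш_an(W/ℚ(ζ₉)⁺) < 2` (instrument C-A2b). [cite: LeiPollackPratap2024, §4.2] -/
@[conjecture] def ForcedShaNineThree : Prop :=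
  ∀ (W : WeierstrassCurve ℚ) [W.IsElliptic] [W.IsGloballyMinimal],
    ClassO5 W 3 → SubTprime W 3 → padicValRat 3 W.Δ = 3 → W.analyticRank = 0 →
    (∀ P : (W.baseChange KOne).toAffine.Point, 3 • P = 0 → P = 0) →
    9 ∣ (W.baseChange KOne).shaOrder

/-! ## §4 T7 — the layer-one λ-law (T1 + T5 at `n = 1`) -/

/-- **T7 LAYER-ONE λ-LAW (CONJECTURE = T1 ∧ T5 at `n = 1`; EVIDENCE-labelled).**  `θ₁ = T · u₁` with
`deg u₁ ≤ 1`, so `λ(θ₁) ∈ {1, 2}`, and the parity law pins it: `λ(θ₁(W)) = 2` iff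
(`W ∈ O5b` ↔ `r_an(W)` even), else `λ(θ₁(W)) = 1`.  Concretely on O5b rank 0: the three coefficients
`2[a/9]⁺`, `a ∈ {1,4,7}`, of `θ₁` are congruent mod `3^{μ+1}` and not all `0 mod 3^{μ+1}`
(`θ₁ ≡ c·(1+γ+γ²)`).  EVIDENCE: every rank-0/1 row of kit j121751/j121825/j122348 at `n = 1`;
census instrument C-A1′ decides it for all 46 067 O5 rows from two numerical periods each.
[cite: MazurTate1987, §1] -/
@[conjecture] def LayerOneLambdaLawThree : Prop :=
  ∀ (W : WeierstrassCurve ℚ) [W.IsElliptic] [W.IsGloballyMinimal] [NeZero (W.conductorNorm ℤ)]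
    (f : CuspForm (Gamma0 (W.conductorNorm ℤ)) 2) (k : ℕ) (Θ : IwasawaAlgebra 3),
    IsNewformOf W f → ClassO5 W 3 → IsScaledMazurTateLift f 1 k Θ → Θ ≠ 0 →
    lam Θ = if (SubTprime W 3 ↔ Even W.analyticRank) then 2 else 1

/-! ## §5 Kernel bookkeeping (nothing asserted) -/

/-- T7 refines T5 at layer one: under `LayerOneLambdaLawThree` the layer-one case of the parity law
holds. [folklore] -/
theorem layerParity_one_of_layerOneLambdaLaw (h : LayerOneLambdaLawThree)
    (W : WeierstrassCurve ℚ) [W.IsElliptic] [W.IsGloballyMinimal] [NeZero (W.conductorNorm ℤ)]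
    (f : CuspForm (Gamma0 (W.conductorNorm ℤ)) 2) (k : ℕ) (Θ : IwasawaAlgebra 3)
    (hf : IsNewformOf W f) (hO : ClassO5 W 3) (hΘ : IsScaledMazurTateLift f 1 k Θ) (hΘ0 : Θ ≠ 0) :
    Even (lam Θ + W.analyticRank) ↔ SubTprime W 3 := by
  have hl := h W f k Θ hf hO hΘ hΘ0
  by_cases hT : SubTprime W 3
  · by_cases hr : Even W.analyticRank
    · have h2 : lam Θ = 2 := by rw [hl, if_pos (iff_of_true hT hr)]
      rw [h2]
      exact iff_of_true (Nat.even_add.mpr ⟨fun _ ↦ hr, fun _ ↦ even_two⟩) hT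
    · have h1 : lam Θ = 1 := by rw [hl, if_neg (fun h' ↦ hr (h'.mp hT))]
      rw [h1]
      exact iff_of_true
        (Nat.even_add.mpr ⟨fun h1' ↦ absurd h1' Nat.not_even_one, fun h' ↦ absurd h' hr⟩) hT
  · by_cases hr : Even W.analyticRank
    · have h1 : lam Θ = 1 := by rw [hl, if_neg (fun h' ↦ hT (h'.mpr hr))]
      rw [h1]
      exact iff_of_false (fun h' ↦ Nat.not_even_one ((Nat.even_add.mp h').mpr hr)) hT
    · have h2 : lam Θ = 2 := by rw [hl, if_pos (iff_of_false hT hr)]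
      rw [h2]
      exact iff_of_false (fun h' ↦ hr ((Nat.even_add.mp h').mp even_two)) hT

end Summit.BirchSwinnertonDyer.Rank1Residual.O5

end
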